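import Summits.Ventures.WeilGRH.TwistedGramEntryBox
import Summits.Ventures.WeilGRH.TwistedWindowClosure
import Summits.RiemannHypothesis.RiemannHypothesis.Theorems.WeilFormatCDataA1TabValid1
import HarnessLib

/-!
# GRH arm (rh-explicit, venture WeilGRH): the NEGATIVE side of the uniform `t = 1` floor — principal characters
  of small modulus FAIL Weil positivity on `[-1, 1]` (the flat window, kernel-evaluated)

Cell `rh-explicit`, WEIL TRACK — GRH ARM (weil-grh-1, gen8).  The arm's uniform statements at `t = 1`
(`UniformConductorFloorJointFloors.lean`: every `χ` mod `q ≥ 78`; `UniformConductorFloorCoprimeFloors.lean`: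
`2 ∣ q ≥ 34`, `3 ∣ q ≥ 45`, `6 ∣ q ≥ 24`; assembled in `UniformConductorFloorCoprimeRemainder.lean` as «every `χ` mod `q`
for every `q` outside an explicit 48-element set `R₀`») quantify over ALL Dirichlet characters of a modulus, the
principal one included.  This file proves that below those floors the statement over all characters is genuinely
FALSE, and locates the obstruction: the PRINCIPAL character `χ₀ = 1` mod `q` (whose twisted form has no polar term and
sees the modulus only through `log q` and the prime powers `2, 3, 4, 5, 7 < e²` it kills) fails `WeilPositivityOnChar 1 1`
for every modulus `q` in the explicit 42-element set

  `F = {2, …, 17, 19, …, 23, 25, …, 29, 31, 33, 35, 37, 39, 41, 43, 47, 49, 53, 55, 59, 61, 67, 71, 73}`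

(`not_weilPositivityOnChar_one_principal`), in particular for EVERY PRIME `p ≤ 73`
(`not_weilPositivityOnChar_one_principal_of_prime_le`).  `F` is `R₀` minus `{0, 1, 18, 32, 65, 77}`: together with the
floors this is an almost complete decision of «`∀ χ` mod `q`, `WeilPositivityOnChar χ 1`» (file
`UniformConductorFloorOneIff.lean`: for prime `q` it holds iff `q ≥ 79`).

THE WITNESS is the FLAT window `χ_0 = 2^{-1/2}·𝟙_{[-1,1]}` (Yoshida's zero mode): by the twisted format-C dictionary
(`TwistedWindowClosure.not_weilPositivityOnChar_of_twistedWindowForm_sum_chi_neg`, weil-3) and the even-real entry theorem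
(`TwistedGramEvenReal.twistedWindowForm_sum_smul_chi_eq_twistedGramCoeff`, weil-grh-1 gen2) its twisted window form is the
single Gram entry `twistedGramCoeff χ₀ 1 0 0 = log q − F_{χ₀}(1)` — weil-3's FLAT-WINDOW INEQUALITY (`TwistedFlatTest.lean`:
`WeilPositivityOnChar χ a ⟹ F_χ(a) ≤ log q`) read as a refutation.  The number `F_{χ₀}(1)` is
`2Σ_{n ∈ {2,3,4,5,7}, (n,q)=1} Λ(n)n^{-1/2}(1 − ½log n) + log 8π + γ + π/2 − ψ′(¼)/4 + Σ_{k≥0} e^{−(4k+1)}/(2k+½)²`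
`= 4.291304 = log 73.06` when `(q, 210) = 1` (so `q ≤ 73` fails and the prime `79 ≥ 78` passes: the dichotomy is exact with
no prime in between), `log 31.13` / `log 41.25` / `log 55.16` / `log 70.21` when exactly `2` / `3` / `5` / `7` divides `q`,
`log 17.57`, `log 23.50`, `log 29.91`, `log 31.14`, `log 39.64`, `log 53.01` for the pairs `{2,3}`, `{2,5}`, `{2,7}`, `{3,5}`,
`{3,7}`, `{5,7}`.  It is EVALUATED IN THE KERNEL (no new transcendental input): the entry box
`TwistedEncl.twistedGramBox` (weil-grh-2, `TwistedGramEntryBox.lean`) on the `ζ` lane's certified special-value table at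
`a = 1` (weil-2, `WeilFormatCData.A1.tab`, record of the mode `0`, `tabv26`), scale `2^256`, with `log q ≤ log Q` enclosed
by `MI.logNat`; one `decide +kernel` per divisibility pattern (the flat-window check of `not_weilPositivityOnChar_of_checkFlat`).

Honest scope: principal characters are not the object of GRH (their `L`-function is `ζ(s)` times a finite Euler product;
the tree's form `weilFunctionalChar` deliberately carries no polar term for `q ≠ 1`); the content is the SHARPNESS of the
arm's uniform-in-`χ` floors and the exact shape of the all-characters statement at `t = 1`.  RH/GRH-free; standard axioms.

## References

* H. Yoshida, *On Hermitian forms attached to zeta functions*, Adv. Stud. Pure Math. 21 (1992) 281–325, §3 (the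
  basis `χ_n`), §5 (5.15) p. 301 (the diagonal entry). [Yoshida1992HermitianForms]
* A. Weil, *Sur les "formules explicites" de la théorie des nombres premiers* (1952), (11) pp. 261–262.
  [Weil1952FormulesExplicites]
* R. E. Moore, *Interval Analysis* (1966), Ch. 3. [Moore1966]
-/

set_option autoImplicit false

noncomputable section

open Real Complex Finset
open scoped BigOperators ArithmeticFunction.vonMangoldt ComplexConjugate

namespace Summit.Ventures.WeilGRH

open Literature.NumberTheory.LFunctions Literature.NumberTheory.LFunctions.Yoshida1992
open Literature.NumberTheory.LFunctions.Yoshida1992.Encl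
open Literature.Analysis.SpecialFunctions Literature.Analysis.ValidatedNumerics.NumericsMP
open TwistedEncl

namespace UniformFloor

variable {q : ℕ}

/-! ## The flat-window refutation, generic in the character -/

/-- **A negative flat-window entry refutes the rung.**  For a real even character `χ` mod `q ≠ 1` with
`Re χ(k_i) = ε_i` on the window's prime powers and `log q ∈ LQ`: if the kernel box of the Gram entry
`twistedGramCoeff χ a 0 0` (the twisted window form of Yoshida's flat window `χ_0`) has negative upper end, then
`¬ WeilPositivityOnChar χ a`. [cite: Yoshida1992HermitianForms, §5 (5.15) p. 301; Moore1966, Ch. 3 (interval arithmetic: inclusion property)] -/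
theorem not_weilPositivityOnChar_of_flatBox_hi_neg {S : ℕ} (hS : 0 < S) {a : ℝ} (ha0 : 0 < a)
    {ks : List PrimeLen} (hks : PrimeData a ks) {C : Consts} (hC : ConstsValid S a ks C)
    (hq : q ≠ 1) (χ : DirichletCharacter ℂ q)
    (hreal : ∀ n : ℕ, conj (χ (n : ZMod q)) = χ (n : ZMod q)) (heven : charParity χ = 0) {εs : List ℤ}
    (hε : ∀ i < ks.length, (χ (((ks.getD i default).val : ℕ) : ZMod q)).re = ((εs.getD i 0 : ℤ) : ℝ))
    {LQ : MI} (hLQ : MI.mem S (Real.log q) LQ) {R : IdxRec} (hR : OffValid S a ks 0 R) (hRd : DiagValid S a 0 R)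
    (hneg : (twistedGramBox S C εs LQ R R 0 0).hi < 0) : ¬ WeilPositivityOnChar χ a := by
  have hmem : MI.mem S (twistedGramCoeff χ a 0 0) (twistedGramBox S C εs LQ R R 0 0) :=
    mem_twistedGramBox hS ha0 hks hC χ hε hLQ hR (fun _ ↦ hRd) hR
  have hlt : twistedGramCoeff χ a 0 0 < 0 := MI.neg_of_hi_neg hmem hneg
  have key := twistedWindowForm_sum_smul_chi_eq_twistedGramCoeff χ hreal heven ha0 {0} (fun _ ↦ (1 : ℂ))
  refine not_weilPositivityOnChar_of_twistedWindowForm_sum_chi_neg hq χ ha0 (s := {0}) (c := fun _ ↦ (1 : ℂ)) ?_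
  rw [key]
  simpa using hlt

/-- The interval `[0, hi(log Q)]` contains `log q` for every `q ≤ Q`. [cite: Moore1966, Ch. 3 (interval arithmetic: inclusion property)] -/
theorem mem_log_of_le {S Q : ℕ} {B : MI} (hB : MI.mem S (Real.log Q) B) (hqQ : q ≤ Q) :
    MI.mem S (Real.log q) ⟨0, B.hi⟩ := by
  have hQ : Real.log q ≤ Real.log Q := by
    rcases Nat.eq_zero_or_pos q with rfl | hq0
    · rw [Nat.cast_zero, Real.log_zero]
      exact Real.log_natCast_nonneg Q
    · exact Real.log_le_log (by exact_mod_cast hq0) (by exact_mod_cast hqQ)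
  constructor
  · show ((0 : ℤ) : ℝ) ≤ Real.log q * S
    rw [Int.cast_zero]
    exact mul_nonneg (Real.log_natCast_nonneg q) (by positivity)
  · show Real.log q * S ≤ (B.hi : ℝ)
    exact (mul_le_mul_of_nonneg_right hQ (by positivity)).trans hB.2

/-- **Soundness of the flat-window check.**  The CHECK for a divisibility pattern is the closed Boolean term
`(MI.logNat S prec Q).elim false (fun B ↦ decide ((twistedGramBox S C εs ⟨0, B.hi⟩ R R 0 0).hi < 0))`: enclose `log Q`,
widen to `[0, hi]` (so that ONE box serves every `q ≤ Q`), evaluate the entry box of `twistedGramCoeff · a 0 0` with prime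
signs `εs` at the record `R` of the mode `0`, and test that its upper end is negative.  A `true` value refutes
`WeilPositivityOnChar χ a` for every real even `χ` mod `q ≠ 1`, `q ≤ Q`, with the listed prime signs.
[cite: Moore1966, Ch. 3 (interval arithmetic: inclusion property)] -/
theorem not_weilPositivityOnChar_of_checkFlat {S : ℕ} (hS : 0 < S) {a : ℝ} (ha0 : 0 < a)
    {ks : List PrimeLen} (hks : PrimeData a ks) {C : Consts} (hC : ConstsValid S a ks C) {prec Q : ℕ} {εs : List ℤ}
    {R : IdxRec} (hR : OffValid S a ks 0 R) (hRd : DiagValid S a 0 R)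
    (h : (MI.logNat S prec Q).elim false (fun B ↦ decide ((twistedGramBox S C εs ⟨0, B.hi⟩ R R 0 0).hi < 0)) = true)
    (hq : q ≠ 1) (hqQ : q ≤ Q) (χ : DirichletCharacter ℂ q)
    (hreal : ∀ n : ℕ, conj (χ (n : ZMod q)) = χ (n : ZMod q)) (heven : charParity χ = 0)
    (hε : ∀ i < ks.length, (χ (((ks.getD i default).val : ℕ) : ZMod q)).re = ((εs.getD i 0 : ℤ) : ℝ)) :
    ¬ WeilPositivityOnChar χ a := by
  cases hB : MI.logNat S prec Q with
  | none => simp [hB] at h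
  | some B =>
    rw [hB, Option.elim_some] at h
    exact not_weilPositivityOnChar_of_flatBox_hi_neg hS ha0 hks hC hq χ hreal heven hε
      (mem_log_of_le (MI.mem_logNat hS hB) hqQ) hR hRd (of_decide_eq_true h)

/-! ## The principal character -/

/-- The principal character is real: `conj χ₀(n) = χ₀(n)` (values `0`, `1`). [folklore] -/
theorem conj_one_apply (x : ZMod q) : conj ((1 : DirichletCharacter ℂ q) x) = (1 : DirichletCharacter ℂ q) x := by
  by_cases hx : IsUnit x
  · rw [MulChar.one_apply hx, map_one]
  · rw [MulChar.map_nonunit _ hx, map_zero]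

/-- The principal character is even: parity `0`. [folklore] -/
theorem charParity_one : charParity (1 : DirichletCharacter ℂ q) = 0 :=
  charParity_of_even (show (1 : DirichletCharacter ℂ q) (-1) = 1 from MulChar.one_apply isUnit_one.neg)

/-- `Re χ₀(k) = 1` if `(k, q) = 1`, `= 0` otherwise. [folklore] -/
theorem re_one_apply_natCast (k : ℕ) :
    ((1 : DirichletCharacter ℂ q) (k : ZMod q)).re = if k.Coprime q then 1 else 0 := by
  by_cases hk : k.Coprime q
  · rw [if_pos hk, MulChar.one_apply ((ZMod.isUnit_iff_coprime k q).2 hk), Complex.one_re]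
  · rw [if_neg hk, MulChar.map_nonunit _ (fun h ↦ hk ((ZMod.isUnit_iff_coprime k q).1 h)), Complex.zero_re]

/-- `(4, q) = 1 ↔ (2, q) = 1`. [folklore] -/
private theorem coprime_four_iff : (4 : ℕ).Coprime q ↔ (2 : ℕ).Coprime q := by
  rw [show (4 : ℕ) = 2 ^ 2 by norm_num]
  exact Nat.coprime_pow_left_iff (by norm_num) 2 q

/-! ## The instance at `a = 1`: the `ζ` lane's table `WeilFormatCData.A1` -/

open Summit.RiemannHypothesis.RiemannHypothesis.Theorems.WeilFormatCData.A1 in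
/-- **The door at `a = 1` for principal characters.**  A `true` flat-window check on the `ζ` lane's constants `C` and the
record `tget tab 0` (valid: `tabv26`) with signs `εs = (𝟙[(2,q)=1], 𝟙[(3,q)=1], 𝟙[(2,q)=1], 𝟙[(5,q)=1], 𝟙[(7,q)=1])` refutes
`WeilPositivityOnChar 1 1` for every modulus `1 ≠ q ≤ Q` with that coprimality pattern. [cite: Yoshida1992HermitianForms, §5 (5.15) p. 301] -/
theorem not_weilPositivityOnChar_one_principal_of_checkFlat {Q : ℕ} {e2 e3 e5 e7 : ℤ}
    (h : (MI.logNat (2 ^ 256) 256 Q).elim false (fun B ↦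
      decide ((twistedGramBox (2 ^ 256) C [e2, e3, e2, e5, e7] ⟨0, B.hi⟩ (tget tab 0) (tget tab 0) 0 0).hi < 0)) = true)
    (hq : q ≠ 1) (hqQ : q ≤ Q)
    (h2 : (if (2 : ℕ).Coprime q then (1 : ℤ) else 0) = e2) (h3 : (if (3 : ℕ).Coprime q then (1 : ℤ) else 0) = e3)
    (h5 : (if (5 : ℕ).Coprime q then (1 : ℤ) else 0) = e5) (h7 : (if (7 : ℕ).Coprime q then (1 : ℤ) else 0) = e7) :
    ¬ WeilPositivityOnChar (1 : DirichletCharacter ℂ q) 1 := by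
  have hS : 0 < (2 : ℕ) ^ 256 := by positivity
  obtain ⟨hR', hRd'⟩ := tabv26 0 (by norm_num)
  have hR : OffValid (2 ^ 256) a ks 0 (tget tab 0) := by simpa using hR'
  have hRd : DiagValid (2 ^ 256) a 0 (tget tab 0) := by simpa using hRd'
  subst h2 h3 h5 h7
  have hε : ∀ i < ks.length, ((1 : DirichletCharacter ℂ q) (((ks.getD i default).val : ℕ) : ZMod q)).re =
      (([(if (2 : ℕ).Coprime q then (1 : ℤ) else 0), (if (3 : ℕ).Coprime q then (1 : ℤ) else 0),
        (if (2 : ℕ).Coprime q then (1 : ℤ) else 0), (if (5 : ℕ).Coprime q then (1 : ℤ) else 0),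
        (if (7 : ℕ).Coprime q then (1 : ℤ) else 0)].getD i 0 : ℤ) : ℝ) := by
    intro i hi
    have hi5 : i < 5 := by simpa [ks] using hi
    interval_cases i
    · show ((1 : DirichletCharacter ℂ q) ((2 ^ 1 : ℕ) : ZMod q)).re = (((if (2 : ℕ).Coprime q then (1 : ℤ) else 0) : ℤ) : ℝ)
      rw [pow_one, re_one_apply_natCast]
      split_ifs <;> simp
    · show ((1 : DirichletCharacter ℂ q) ((3 ^ 1 : ℕ) : ZMod q)).re = (((if (3 : ℕ).Coprime q then (1 : ℤ) else 0) : ℤ) : ℝ)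
      rw [pow_one, re_one_apply_natCast]
      split_ifs <;> simp
    · show ((1 : DirichletCharacter ℂ q) ((2 ^ 2 : ℕ) : ZMod q)).re = (((if (2 : ℕ).Coprime q then (1 : ℤ) else 0) : ℤ) : ℝ)
      rw [show (2 ^ 2 : ℕ) = 4 from rfl, re_one_apply_natCast, if_congr coprime_four_iff rfl rfl]
      split_ifs <;> simp
    · show ((1 : DirichletCharacter ℂ q) ((5 ^ 1 : ℕ) : ZMod q)).re = (((if (5 : ℕ).Coprime q then (1 : ℤ) else 0) : ℤ) : ℝ)
      rw [pow_one, re_one_apply_natCast]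
      split_ifs <;> simp
    · show ((1 : DirichletCharacter ℂ q) ((7 ^ 1 : ℕ) : ZMod q)).re = (((if (7 : ℕ).Coprime q then (1 : ℤ) else 0) : ℤ) : ℝ)
      rw [pow_one, re_one_apply_natCast]
      split_ifs <;> simp
  have hmain := not_weilPositivityOnChar_of_checkFlat hS a_pos primeData consts_valid hR hRd h hq hqQ
    (1 : DirichletCharacter ℂ q) (fun n ↦ conj_one_apply _) charParity_one hε
  simpa using hmain

/-! ## The eleven divisibility patterns (kernel facts) -/

open Summit.RiemannHypothesis.RiemannHypothesis.Theorems.WeilFormatCData.A1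

/-- kernel: `(q, 210) = 1`, `q ≤ 73` — flat entry `< 0` (`F = log 73.06`). [cite: Moore1966, Ch. 3 (interval arithmetic: inclusion property)] -/
theorem tFlat73 : (MI.logNat (2 ^ 256) 256 73).elim false (fun B ↦
    decide ((twistedGramBox (2 ^ 256) C [1, 1, 1, 1, 1] ⟨0, B.hi⟩ (tget tab 0) (tget tab 0) 0 0).hi < 0)) = true := by
  decide +kernel
/-- kernel: exactly `2 ∣ q` among `2, 3, 5, 7`, `q ≤ 26` (`F = log 31.13`). [cite: Moore1966, Ch. 3 (interval arithmetic: inclusion property)] -/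
theorem tFlat2 : (MI.logNat (2 ^ 256) 256 26).elim false (fun B ↦
    decide ((twistedGramBox (2 ^ 256) C [0, 1, 0, 1, 1] ⟨0, B.hi⟩ (tget tab 0) (tget tab 0) 0 0).hi < 0)) = true := by
  decide +kernel
/-- kernel: exactly `3 ∣ q`, `q ≤ 39` (`F = log 41.25`). [cite: Moore1966, Ch. 3 (interval arithmetic: inclusion property)] -/
theorem tFlat3 : (MI.logNat (2 ^ 256) 256 39).elim false (fun B ↦
    decide ((twistedGramBox (2 ^ 256) C [1, 0, 1, 1, 1] ⟨0, B.hi⟩ (tget tab 0) (tget tab 0) 0 0).hi < 0)) = true := by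
  decide +kernel
/-- kernel: exactly `5 ∣ q`, `q ≤ 55` (`F = log 55.16`). [cite: Moore1966, Ch. 3 (interval arithmetic: inclusion property)] -/
theorem tFlat5 : (MI.logNat (2 ^ 256) 256 55).elim false (fun B ↦
    decide ((twistedGramBox (2 ^ 256) C [1, 1, 1, 0, 1] ⟨0, B.hi⟩ (tget tab 0) (tget tab 0) 0 0).hi < 0)) = true := by
  decide +kernel
/-- kernel: exactly `7 ∣ q`, `q ≤ 49` (`F = log 70.21`). [cite: Moore1966, Ch. 3 (interval arithmetic: inclusion property)] -/
theorem tFlat7 : (MI.logNat (2 ^ 256) 256 49).elim false (fun B ↦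
    decide ((twistedGramBox (2 ^ 256) C [1, 1, 1, 1, 0] ⟨0, B.hi⟩ (tget tab 0) (tget tab 0) 0 0).hi < 0)) = true := by
  decide +kernel
/-- kernel: exactly `2, 3 ∣ q`, `q ≤ 12` (`F = log 17.57`). [cite: Moore1966, Ch. 3 (interval arithmetic: inclusion property)] -/
theorem tFlat23 : (MI.logNat (2 ^ 256) 256 12).elim false (fun B ↦
    decide ((twistedGramBox (2 ^ 256) C [0, 0, 0, 1, 1] ⟨0, B.hi⟩ (tget tab 0) (tget tab 0) 0 0).hi < 0)) = true := by
  decide +kernel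
/-- kernel: exactly `2, 5 ∣ q`, `q ≤ 20` (`F = log 23.50`). [cite: Moore1966, Ch. 3 (interval arithmetic: inclusion property)] -/
theorem tFlat25 : (MI.logNat (2 ^ 256) 256 20).elim false (fun B ↦
    decide ((twistedGramBox (2 ^ 256) C [0, 1, 0, 0, 1] ⟨0, B.hi⟩ (tget tab 0) (tget tab 0) 0 0).hi < 0)) = true := by
  decide +kernel
/-- kernel: exactly `2, 7 ∣ q`, `q ≤ 28` (`F = log 29.91`). [cite: Moore1966, Ch. 3 (interval arithmetic: inclusion property)] -/
theorem tFlat27 : (MI.logNat (2 ^ 256) 256 28).elim false (fun B ↦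
    decide ((twistedGramBox (2 ^ 256) C [0, 1, 0, 1, 0] ⟨0, B.hi⟩ (tget tab 0) (tget tab 0) 0 0).hi < 0)) = true := by
  decide +kernel
/-- kernel: exactly `3, 5 ∣ q`, `q ≤ 15` (`F = log 31.14`). [cite: Moore1966, Ch. 3 (interval arithmetic: inclusion property)] -/
theorem tFlat35 : (MI.logNat (2 ^ 256) 256 15).elim false (fun B ↦
    decide ((twistedGramBox (2 ^ 256) C [1, 0, 1, 0, 1] ⟨0, B.hi⟩ (tget tab 0) (tget tab 0) 0 0).hi < 0)) = true := by
  decide +kernel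
/-- kernel: exactly `3, 7 ∣ q`, `q ≤ 21` (`F = log 39.64`). [cite: Moore1966, Ch. 3 (interval arithmetic: inclusion property)] -/
theorem tFlat37 : (MI.logNat (2 ^ 256) 256 21).elim false (fun B ↦
    decide ((twistedGramBox (2 ^ 256) C [1, 0, 1, 1, 0] ⟨0, B.hi⟩ (tget tab 0) (tget tab 0) 0 0).hi < 0)) = true := by
  decide +kernel
/-- kernel: exactly `5, 7 ∣ q`, `q ≤ 35` (`F = log 53.01`). [cite: Moore1966, Ch. 3 (interval arithmetic: inclusion property)] -/
theorem tFlat57 : (MI.logNat (2 ^ 256) 256 35).elim false (fun B ↦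
    decide ((twistedGramBox (2 ^ 256) C [1, 1, 1, 0, 0] ⟨0, B.hi⟩ (tget tab 0) (tget tab 0) 0 0).hi < 0)) = true := by
  decide +kernel

/-! ## The explicit set of failing moduli -/

set_option maxRecDepth 100000 in
/-- The pattern dispatch of `F`: every member has one of the eleven certified coprimality patterns with the matching bound.
[folklore] -/
theorem principalFailures_dispatch : ∀ q ∈ ({2, 3, 4, 5, 6, 7, 8, 9, 10, 11, 12, 13, 14, 15, 16, 17, 19, 20, 21, 22, 23, 25, 26, 27, 28, 29, 31, 33, 35, 37,
      39, 41, 43, 47, 49, 53, 55, 59, 61, 67, 71, 73} : Finset ℕ),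
    ((2 : ℕ).Coprime q ∧ (3 : ℕ).Coprime q ∧ (5 : ℕ).Coprime q ∧ (7 : ℕ).Coprime q ∧ q ≤ 73) ∨
    (¬ (2 : ℕ).Coprime q ∧ (3 : ℕ).Coprime q ∧ (5 : ℕ).Coprime q ∧ (7 : ℕ).Coprime q ∧ q ≤ 26) ∨
    ((2 : ℕ).Coprime q ∧ ¬ (3 : ℕ).Coprime q ∧ (5 : ℕ).Coprime q ∧ (7 : ℕ).Coprime q ∧ q ≤ 39) ∨
    ((2 : ℕ).Coprime q ∧ (3 : ℕ).Coprime q ∧ ¬ (5 : ℕ).Coprime q ∧ (7 : ℕ).Coprime q ∧ q ≤ 55) ∨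
    ((2 : ℕ).Coprime q ∧ (3 : ℕ).Coprime q ∧ (5 : ℕ).Coprime q ∧ ¬ (7 : ℕ).Coprime q ∧ q ≤ 49) ∨
    (¬ (2 : ℕ).Coprime q ∧ ¬ (3 : ℕ).Coprime q ∧ (5 : ℕ).Coprime q ∧ (7 : ℕ).Coprime q ∧ q ≤ 12) ∨
    (¬ (2 : ℕ).Coprime q ∧ (3 : ℕ).Coprime q ∧ ¬ (5 : ℕ).Coprime q ∧ (7 : ℕ).Coprime q ∧ q ≤ 20) ∨
    (¬ (2 : ℕ).Coprime q ∧ (3 : ℕ).Coprime q ∧ (5 : ℕ).Coprime q ∧ ¬ (7 : ℕ).Coprime q ∧ q ≤ 28) ∨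
    ((2 : ℕ).Coprime q ∧ ¬ (3 : ℕ).Coprime q ∧ ¬ (5 : ℕ).Coprime q ∧ (7 : ℕ).Coprime q ∧ q ≤ 15) ∨
    ((2 : ℕ).Coprime q ∧ ¬ (3 : ℕ).Coprime q ∧ (5 : ℕ).Coprime q ∧ ¬ (7 : ℕ).Coprime q ∧ q ≤ 21) ∨
    ((2 : ℕ).Coprime q ∧ (3 : ℕ).Coprime q ∧ ¬ (5 : ℕ).Coprime q ∧ ¬ (7 : ℕ).Coprime q ∧ q ≤ 35) := by
  decide +kernel

set_option maxRecDepth 100000 in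
/-- Every modulus `n < 74` outside `F` is `0`, `1` or composite (explicit divisor) — so every prime `p ≤ 73` lies in `F`.
[folklore] -/
theorem principalFailures_complement : ∀ n < 74,
    n ∉ ({2, 3, 4, 5, 6, 7, 8, 9, 10, 11, 12, 13, 14, 15, 16, 17, 19, 20, 21, 22, 23, 25, 26, 27, 28, 29, 31, 33, 35, 37,
      39, 41, 43, 47, 49, 53, 55, 59, 61, 67, 71, 73} : Finset ℕ) →
    n < 2 ∨ ∃ d < n, 2 ≤ d ∧ d ∣ n := by
  decide +kernel

/-- ★ **The principal character of every modulus in `F` fails Weil positivity on `[-1, 1]`.**  The witness is the flat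
window; the obstruction value is `twistedGramCoeff 1 1 0 0 = log q − F_{χ₀}(1) < 0`.
[cite: Yoshida1992HermitianForms, §5 (5.15) p. 301; Weil1952FormulesExplicites, (11) pp. 261–262] -/
theorem not_weilPositivityOnChar_one_principal
    (hq : q ∈ ({2, 3, 4, 5, 6, 7, 8, 9, 10, 11, 12, 13, 14, 15, 16, 17, 19, 20, 21, 22, 23, 25, 26, 27, 28, 29, 31, 33, 35, 37,
      39, 41, 43, 47, 49, 53, 55, 59, 61, 67, 71, 73} : Finset ℕ)) :
    ¬ WeilPositivityOnChar (1 : DirichletCharacter ℂ q) 1 := by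
  have hq1 : q ≠ 1 := by
    rintro rfl
    exact absurd hq (by decide)
  rcases principalFailures_dispatch q hq with ⟨h2, h3, h5, h7, hle⟩ | ⟨h2, h3, h5, h7, hle⟩ | ⟨h2, h3, h5, h7, hle⟩ |
      ⟨h2, h3, h5, h7, hle⟩ | ⟨h2, h3, h5, h7, hle⟩ | ⟨h2, h3, h5, h7, hle⟩ | ⟨h2, h3, h5, h7, hle⟩ | ⟨h2, h3, h5, h7, hle⟩ |
      ⟨h2, h3, h5, h7, hle⟩ | ⟨h2, h3, h5, h7, hle⟩ | ⟨h2, h3, h5, h7, hle⟩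
  · exact not_weilPositivityOnChar_one_principal_of_checkFlat tFlat73 hq1 hle (if_pos h2) (if_pos h3) (if_pos h5) (if_pos h7)
  · exact not_weilPositivityOnChar_one_principal_of_checkFlat tFlat2 hq1 hle (if_neg h2) (if_pos h3) (if_pos h5) (if_pos h7)
  · exact not_weilPositivityOnChar_one_principal_of_checkFlat tFlat3 hq1 hle (if_pos h2) (if_neg h3) (if_pos h5) (if_pos h7)
  · exact not_weilPositivityOnChar_one_principal_of_checkFlat tFlat5 hq1 hle (if_pos h2) (if_pos h3) (if_neg h5) (if_pos h7)
  · exact not_weilPositivityOnChar_one_principal_of_checkFlat tFlat7 hq1 hle (if_pos h2) (if_pos h3) (if_pos h5) (if_neg h7)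
  · exact not_weilPositivityOnChar_one_principal_of_checkFlat tFlat23 hq1 hle (if_neg h2) (if_neg h3) (if_pos h5) (if_pos h7)
  · exact not_weilPositivityOnChar_one_principal_of_checkFlat tFlat25 hq1 hle (if_neg h2) (if_pos h3) (if_neg h5) (if_pos h7)
  · exact not_weilPositivityOnChar_one_principal_of_checkFlat tFlat27 hq1 hle (if_neg h2) (if_pos h3) (if_pos h5) (if_neg h7)
  · exact not_weilPositivityOnChar_one_principal_of_checkFlat tFlat35 hq1 hle (if_pos h2) (if_neg h3) (if_neg h5) (if_pos h7)
  · exact not_weilPositivityOnChar_one_principal_of_checkFlat tFlat37 hq1 hle (if_pos h2) (if_neg h3) (if_pos h5) (if_neg h7)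
  · exact not_weilPositivityOnChar_one_principal_of_checkFlat tFlat57 hq1 hle (if_pos h2) (if_pos h3) (if_neg h5) (if_neg h7)

/-- **Every principal character modulo a number `1 ≠ q ≤ 73` coprime to `210` fails** — in particular EVERY PRIME `p ≤ 73`
other than `2, 3, 5, 7` by this clause, and those four by `F`. [cite: Weil1952FormulesExplicites, (11) pp. 261–262] -/
theorem not_weilPositivityOnChar_one_principal_of_coprime (hq1 : q ≠ 1) (hq : q ≤ 73) (hcop : q.Coprime 210) :
    ¬ WeilPositivityOnChar (1 : DirichletCharacter ℂ q) 1 := by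
  have h2 : (2 : ℕ).Coprime q := Nat.Coprime.symm (Nat.Coprime.coprime_dvd_right (by norm_num) hcop)
  have h3 : (3 : ℕ).Coprime q := Nat.Coprime.symm (Nat.Coprime.coprime_dvd_right (by norm_num) hcop)
  have h5 : (5 : ℕ).Coprime q := Nat.Coprime.symm (Nat.Coprime.coprime_dvd_right (by norm_num) hcop)
  have h7 : (7 : ℕ).Coprime q := Nat.Coprime.symm (Nat.Coprime.coprime_dvd_right (by norm_num) hcop)
  exact not_weilPositivityOnChar_one_principal_of_checkFlat tFlat73 hq1 hq (if_pos h2) (if_pos h3) (if_pos h5) (if_pos h7)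

/-- ★ **For every prime `p ≤ 73` the principal character mod `p` fails Weil positivity on `[-1, 1]`** (so «every character
mod `p`» is false there, while it is a theorem for `p ≥ 79` — `UniformConductorFloorJointFloors`).
[cite: Weil1952FormulesExplicites, (11) pp. 261–262] -/
theorem not_weilPositivityOnChar_one_principal_of_prime_le (hp : q.Prime) (hq : q ≤ 73) :
    ¬ WeilPositivityOnChar (1 : DirichletCharacter ℂ q) 1 := by
  refine not_weilPositivityOnChar_one_principal ?_
  by_contra hmem
  rcases principalFailures_complement q (by omega) hmem with h | ⟨d, hdq, hd2, hdvd⟩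
  · exact absurd hp.two_le (by omega)
  · rcases (Nat.dvd_prime hp).1 hdvd with rfl | rfl <;> omega

end UniformFloor

end Summit.Ventures.WeilGRH

end
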